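import Literature.AlgebraicGeometry.Motives.AbelianVarietyTheoremOfCube
import Literature.AlgebraicGeometry.Motives.SeesawSemicontinuity
import Literature.AlgebraicGeometry.Motives.SeesawTheorem
import Literature.AlgebraicGeometry.Motives.SeesawGrauertAffineCech
import Literature.AlgebraicGeometry.Motives.GrothendieckComplexSectionAlongCechProofs
import Literature.AlgebraicGeometry.Motives.TheoremOfCubeFormalLiftProofs
import Literature.AlgebraicGeometry.Motives.TheoremOfCubeLimitProofs
import Literature.AlgebraicGeometry.Motives.CubeStepI
import Literature.AlgebraicGeometry.Motives.CechComplexPseudoCoherentDescent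
import Literature.AlgebraicGeometry.Motives.CechComplexPseudoCoherentGeneralProofs
import HarnessLib

/-!
# The theorem of the cube from the seesaw theorem (Görtz–Wedhorn II, proof of Thm. 24.73)

`Motives/AbelianVarietyTheoremOfCube` records the Theorem of the Cube over a field
(Görtz–Wedhorn II, Thm. 24.73, divisor form) as the named fact `theoremOfCube_linEquiv`;
`Motives/SeesawTheorem` vendors the three results its printed proof (p. 550) is assembled from, as
named facts in the same language:

* `seesaw_isClosed_trivialLocus` (Thm. 24.66 (1), (3)): the locus `Z ⊆ T` of fibres on which
  `𝒪(D)` is trivial is closed;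
* `theoremOfCube_isOpen_trivialLocus` (Lemma 24.72 with the Künneth formula, as in the proof of
  Thm. 24.73): in the situation of the theorem of the cube `Z` is open;
* `seesaw_exists_linEquiv_classPullback` (Thm. 24.66): if `Z = T` then `D ∼ pr_T^* M`.

This file proves the assembly `theoremOfCube_linEquiv_of_seesaw`: for `T` integral (hence
connected) and `t₀ ∈ Z` a rational point, `Z` is open, closed and non-empty, so `Z = T` and
`D ∼ pr_T^* M`; restricting to `{x} × Y × T` gives `pr_T^* M ∼ 0` on `Y × T`, and restricting
further along the section `y` gives `M ∼ 0`, whence `D ∼ 0` ("this shows that `c(𝓛)` is trivial",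
loc. cit.). The statement of `theoremOfCube_linEquiv` lives on `X ×_K (Y ×_K T)` while the seesaw
facts see the family `(X ×_K Y) ×_K T → T`; the transport along the associator and the
identification of the fibre over the rational point `t₀` with the slice `X × Y × {t₀}`
(`residuePtι_apply_eq`) are the proved lemmas `whiskerRight_sliceLeft_comp_associator`,
`whiskerRight_sliceRight_comp_associator`, `whiskerLeft_residuePtι_comp_associator` below (checked
componentwise in the cartesian monoidal category `Over (Spec K)`).

So `theoremOfCube_linEquiv` — and with it the cubical structure `cubicalStructure_linEquiv A`,
`[n]^*D ∼ n² D` (`pullback_zsmul_id_linEquiv A`) and `deg [n]_A = n^{2g}` — now rests on the three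
named facts of `Motives/SeesawTheorem`, i.e. on coherent cohomology and base change for proper
morphisms (absent from Mathlib), and `theoremOfCube_linEquiv_holds` will be
`theoremOfCube_linEquiv_of_seesaw` applied to their discharges. The first of them,
`seesaw_isClosed_trivialLocus` (Thm. 24.66 (3)), is proved in `Motives/SeesawSemicontinuity` from
the semicontinuity theorem (Thm. 23.139 (2), named fact `semicontinuity_isClosed_sectionLocus`)
and Lemma 24.65 (`Motives/CartierDivisorProperTrivial`); `theoremOfCube_linEquiv_of_semicontinuity`
records the resulting dependence of the theorem of the cube on Thm. 23.139 (2), Thm. 24.66 and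
Lemma 24.72.

**The trust base after the decomposition of the three seesaw facts (added).** The directory now
decomposes each of the three named facts along its printed proof down to the Čech complex
`Č•(𝔚, 𝒪(D)|_{pr_T⁻¹V})` of `Motives/CartierDivisorCech`: `seesaw_isClosed_trivialLocus` and
`seesaw_exists_linEquiv_classPullback` follow from the perfectness of that complex
(`seesaw_isClosed_trivialLocus_of_perfect`, `Motives/CechComplexH0Fibre`;
`grothendieckComplex_sectionsOver_of_perfect`, `Motives/SeesawGrauertAffineCech`, with
`Motives/SeesawGrauert`), perfectness follows from pseudo-coherence
(`cechComplex_perfect_of_pseudoCoherent`, `Motives/GrothendieckComplexCech`), and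
`theoremOfCube_isOpen_trivialLocus` follows (`Motives/TheoremOfCubeLocal`, `…Limit`, `…LimitProofs`,
`…Thickenings`, `…FormalLift`, `…FormalLiftProofs`, `Motives/GrothendieckComplexSectionAlongCech[Proofs]`)
from Step (I) of the proof of Lemma 24.72 (`theoremOfCube_trivialAlong_thickeningPt`), the theorem
on formal functions for `H⁰` of `𝒪(D)` — itself reduced to Cor. 23.137
(`grothendieckComplex_sectionAlong`) and thence to the pseudo-coherence of the Čech complex — and
the descent of the fibre condition along a limit presentation of the base
(`trivialLocus_descendsAlongStages`). The section `Leaves` below composes these reductions: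
`theoremOfCube_linEquiv_of_pseudoCoherent_of_stepI_of_fibre` proves the theorem of the cube from
exactly three named facts — `cechComplex_pseudoCoherent_general` (Görtz–Wedhorn II, Thm. 23.133 /
Cor. 23.135: finiteness of coherent cohomology of proper morphisms, for `𝒪(D)` in Čech form),
`theoremOfCube_trivialAlong_thickeningPt` (Lemma 24.72, Step (I): deformation theory and the
Künneth formula) and `trivialLocus_descendsAlongStages` (a Stacks 01ZR/0B8W-type limit argument) —
and records on the way the corresponding conditional discharges of
`semicontinuity_isClosed_sectionLocus`, `grothendieckComplex_sectionAlong`,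
`formalFunctions_exists_isSectionOver_restrict`,
`isTrivialOver_nhds_of_trivialAlong_thickeningPt` (Step (II) of Lemma 24.72, now resting on the
Čech pseudo-coherence alone) and `theoremOfCube_isTrivialOver_nhds` (the conclusion of Lemma 24.72
for `𝒪(D)`, `Motives/TheoremOfCubeLocal`).
`theoremOfCube_linEquiv_holds` will be this theorem applied to the three discharges.

**One leaf left (added).** Two of the three leaves are meanwhile theorems of this tree:
`trivialLocus_descendsAlongStages_holds` (`Motives/TheoremOfCubeLimitProofs`) and
`theoremOfCube_trivialAlong_thickeningPt_holds` (`Motives/CubeStepI`: Step (I) of the proof of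
Lemma 24.72 by induction along `𝒪_{T,t}/𝔪ⁿ⁺¹`, the obstruction class and the Künneth injectivity
on the fibre). The section `OneLeaf` below feeds them in:
`theoremOfCube_linEquiv_of_pseudoCoherent_general` proves the Theorem of the Cube from the single
named fact `cechComplex_pseudoCoherent_general` — the pseudo-coherence of the Čech complex of
`𝒪(D)` over an affine open of the base, i.e. the finiteness theorem for the coherent cohomology of
proper morphisms (Görtz–Wedhorn II, Thm. 23.133 / Cor. 23.135; EGA III 3.2.1) in Čech form —
together with the same one-hypothesis forms of the openness of the trivial locus
(`theoremOfCube_isOpen_trivialLocus`), of the cubical structure and of `[n]^*D ∼ n² D` (that of the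
conclusion of Lemma 24.72 itself, `theoremOfCube_isTrivialOver_nhds_of_pseudoCoherent_general`, is
in `Motives/TheoremOfCubeLocalProofs`). The final discharge is now the one-liner
`theoremOfCube_linEquiv_holds := theoremOfCube_linEquiv_of_pseudoCoherent_general cechComplex_pseudoCoherent_general_holds`.

**Down to the finiteness theorem over a noetherian base (added).** Step (IV) of the printed proof
of Görtz–Wedhorn II, Thm. 23.133 (noetherian approximation) is meanwhile proved for the Čech
complex of `𝒪(D)` (`Motives/CechCoverDescent`, `Motives/CechCoverDescentStage`,
`Motives/CechComplexPseudoCoherentDescent`, `Literature/Algebra/Homology/OrderedCechExtendScalars`):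
`cechComplex_pseudoCoherent_general_of_finite_cohomology` reduces the last leaf to the finiteness
of the Čech cohomology modules `Hⁿ(Č•(𝔚₀, 𝒪(D₀)))` for `X ×_K T₀ → T₀` proper over an affine
integral base `T₀` of finite type over `K` — Steps (I)–(III), the finiteness theorem for proper
morphisms (Thm. 23.17; EGA III 3.2.1). The section `NoetherianFiniteness` records the Theorem of
the Cube (and the cubical structure, `[n]^*D ∼ n² D`) as consequences of that single statement,
spelled out as the hypothesis `h`.

**The Theorem of the Cube is a theorem of this tree (added).** The last leaf has landed:
`cechComplex_pseudoCoherent_general_holds` (`Motives/CechComplexPseudoCoherentGeneralProofs`: Chow's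
lemma, Serre's theorems and Leray's comparison for the Chow cover, assembled into the Chow families
of the dévissage). The section `Discharge` below records the resulting unconditional theorem
`theoremOfCube_linEquiv_holds` (Görtz–Wedhorn II, Thm. 24.73 over a field, in divisor form — the
named fact `theoremOfCube_linEquiv` of `Motives/AbelianVarietyTheoremOfCube`); the cubical structure
(Prop. 27.167) and `[n]^*D ∼ n² D` (Prop. 27.184 (1)) follow by
`AbelianVariety.cubicalStructure_linEquiv_of_theoremOfCube` /
`AbelianVariety.pullback_zsmul_id_linEquiv_of_theoremOfCube` (`Motives/AbelianVarietyTheoremOfCube`).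

## References

* U. Görtz, T. Wedhorn, *Algebraic Geometry II: Cohomology of Schemes*, Springer Spektrum (2023),
  doi:10.1007/978-3-658-43031-3: Thm. 24.66, Lemma 24.72, Thm. 24.73 and its proof, pp. 542–550
  (read via the held copy). [GortzWedhorn2023]
* D. Mumford, *Abelian Varieties*, TIFR Studies in Mathematics 5 (1970): §5, Cor. 6 and §6,
  theorem of the cube. [MumfordAV1970]
-/

universe u

open CategoryTheory CategoryTheory.Limits AlgebraicGeometry MonoidalCategory
open CartesianMonoidalCategory

noncomputable section

namespace Literature.AlgebraicGeometry.Motives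

variable {K : Type u} [Field K]

/-! ### Slices of `(X × Y) × T` versus slices of `X × (Y × T)` -/

section Slices

variable (X Y T : SchemeOver K)

/-- `{x} × Y × T`: the slice `Y × T → (X × Y) × T` followed by the associator is the slice
`Y × T → X × (Y × T)` of `theoremOfCube_linEquiv`. [folklore] -/
theorem whiskerRight_sliceLeft_comp_associator (x : 𝟙_ (SchemeOver K) ⟶ X) :
    (((λ_ Y).inv ≫ x ▷ Y) ▷ T) ≫ (α_ X Y T).hom = (λ_ (Y ⊗ T)).inv ≫ x ▷ (Y ⊗ T) := by
  ext <;> simp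

/-- `X × {y} × T`: the slice `X × T → (X × Y) × T` followed by the associator is the slice
`X × T → X × (Y × T)` of `theoremOfCube_linEquiv`. [folklore] -/
theorem whiskerRight_sliceRight_comp_associator (y : 𝟙_ (SchemeOver K) ⟶ Y) :
    (((ρ_ X).inv ≫ X ◁ y) ▷ T) ≫ (α_ X Y T).hom = X ◁ ((λ_ T).inv ≫ y ▷ T) := by
  ext <;> simp

/-- `X × Y × {t₀}`: for a rational point `t₀ ∈ T(K)` with underlying point `t`, the fibre
`(X × Y) × Spec κ(t) → (X × Y) × T` followed by the associator factors through the slice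
`X × Y → X × (Y × T)` of `theoremOfCube_linEquiv` (via the projection onto `X × Y`), because
`Spec κ(t) → T` is `Spec κ(t) → Spec K —t₀→ T` (`residuePtι_apply_eq`). [folklore] -/
theorem whiskerLeft_residuePtι_comp_associator (t₀ : 𝟙_ (SchemeOver K) ⟶ T)
    (s : (𝟙_ (SchemeOver K)).left) :
    ((X ⊗ Y) ◁ residuePtι T (t₀.left s)) ≫ (α_ X Y T).hom =
      fst (X ⊗ Y) (residuePt T (t₀.left s)) ≫ X ◁ ((ρ_ Y).inv ≫ Y ◁ t₀) := by
  rw [residuePtι_apply_eq]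
  ext <;> simp

end Slices

/-! ### The assembly -/

/-- **The theorem of the cube from the seesaw theorem and its local form** (Görtz–Wedhorn II,
proof of Thm. 24.73, p. 550, over a field and in divisor form): given the closedness of the
trivial locus `Z` (Thm. 24.66 (3), `seesaw_isClosed_trivialLocus`), the existence of `M` with
`D ∼ pr_T^*M` when `Z = T` (Thm. 24.66, `seesaw_exists_linEquiv_classPullback`) and the openness of
`Z` in the cube situation (Lemma 24.72 + Künneth, `theoremOfCube_isOpen_trivialLocus`), the theorem
of the cube `theoremOfCube_linEquiv` follows: transport `D` to `D' = α^*D` on `(X × Y) × T`; its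
trivial locus is open and closed and contains the point under the rational point `t₀` (the fibre
there factors through the slice `X × Y × {t₀}`), hence is all of the irreducible, so connected,
`T`; thus `D' ∼ pr_T^*M`; restricting along `{x} × Y × T → (X × Y) × T` gives `pr_T^*M ∼ 0` on
`Y × T`, and along the section `T = {y} × T → Y × T` gives `M ∼ 𝟙^*M ∼ 0`; so `D' ∼ 0` and
`D ∼ (α⁻¹)^*D' ∼ 0`. [cite: GortzWedhorn2023, Thm. 24.73, proof (p. 550)] -/
theorem theoremOfCube_linEquiv_of_seesaw (hA : seesaw_isClosed_trivialLocus.{u})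
    (hB : seesaw_exists_linEquiv_classPullback.{u}) (hC : theoremOfCube_isOpen_trivialLocus.{u}) :
    theoremOfCube_linEquiv.{u} := by
  intro K _ X Y T _ _ _ _ _ _ _ _ _ x y t₀ D hx hy ht
  -- `(X × Y) × T ≅ X × (Y × T)` is integral
  haveI : IsIntegral ((X ⊗ Y) ⊗ T).left := IsIntegral.of_isIso (α_ X Y T).inv.left
  -- the transported divisor `D' = α^* D` and its two trivial slices
  have hx' : ((D.classPullback (α_ X Y T).hom.left).classPullback
      (((λ_ Y).inv ≫ x ▷ Y) ▷ T).left).LinEquiv 0 := by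
    refine (D.classPullback_comp_linEquiv (α_ X Y T).hom.left _).symm.trans ?_
    rw [← Over.comp_left, whiskerRight_sliceLeft_comp_associator]
    exact hx
  have hy' : ((D.classPullback (α_ X Y T).hom.left).classPullback
      (((ρ_ X).inv ≫ X ◁ y) ▷ T).left).LinEquiv 0 := by
    refine (D.classPullback_comp_linEquiv (α_ X Y T).hom.left _).symm.trans ?_
    rw [← Over.comp_left, whiskerRight_sliceRight_comp_associator]
    exact hy
  -- its trivial locus is open (cube, local form), closed (seesaw) and contains `t₀`
  have hU : IsOpen (CartierDivisor.trivialLocus (X ⊗ Y) T (D.classPullback (α_ X Y T).hom.left)) :=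
    hC K X Y T x y _ hx' hy'
  have hZ : IsClosed (CartierDivisor.trivialLocus (X ⊗ Y) T
      (D.classPullback (α_ X Y T).hom.left)) :=
    hA K (X ⊗ Y) T _
  have hs : Nonempty (𝟙_ (SchemeOver K)).left := inferInstanceAs (Nonempty (Spec (.of K)))
  obtain ⟨s⟩ := hs
  have hp : t₀.left s ∈ CartierDivisor.trivialLocus (X ⊗ Y) T
      (D.classPullback (α_ X Y T).hom.left) := by
    rw [CartierDivisor.mem_trivialLocus_iff]
    refine (D.classPullback_comp_linEquiv (α_ X Y T).hom.left _).symm.trans ?_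
    rw [← Over.comp_left, whiskerLeft_residuePtι_comp_associator, Over.comp_left]
    exact (D.classPullback_comp_linEquiv _ _).trans (ht.classPullback_zero _)
  -- `T` is irreducible, hence connected: every fibre is trivial
  have huniv : CartierDivisor.trivialLocus (X ⊗ Y) T (D.classPullback (α_ X Y T).hom.left) =
      Set.univ :=
    IsClopen.eq_univ ⟨hZ, hU⟩ ⟨_, hp⟩
  -- seesaw: `D' ∼ pr_T^* M`
  obtain ⟨M, hM⟩ := hB K (X ⊗ Y) T (D.classPullback (α_ X Y T).hom.left)
    (fun t => by rw [huniv]; exact Set.mem_univ t)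
  -- `pr_T^* M ∼ 0` on `{x} × Y × T = Y × T`
  have e1 : (((λ_ Y).inv ≫ x ▷ Y) ▷ T) ≫ snd (X ⊗ Y) T = snd Y T := by simp
  have h1 : (M.classPullback (snd Y T).left).LinEquiv 0 := by
    have h := M.classPullback_comp_linEquiv (snd (X ⊗ Y) T).left (((λ_ Y).inv ≫ x ▷ Y) ▷ T).left
    rw [← Over.comp_left, e1] at h
    exact h.trans ((hM.classPullback _).symm.trans hx')
  -- `M ∼ 0` by restriction along the section `T = {y} × T → Y × T`
  have e2 : ((λ_ T).inv ≫ y ▷ T) ≫ snd Y T = 𝟙 T := by simp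
  have h2 : M.LinEquiv 0 := by
    have h := M.classPullback_comp_linEquiv (snd Y T).left ((λ_ T).inv ≫ y ▷ T).left
    rw [← Over.comp_left, e2, Over.id_left] at h
    exact (M.classPullback_id_linEquiv.symm.trans h).trans (h1.classPullback_zero _)
  -- hence `D' ∼ 0` and `D ∼ (α⁻¹)^* D' ∼ 0`
  have h3 : (D.classPullback (α_ X Y T).hom.left).LinEquiv 0 := hM.trans (h2.classPullback_zero _)
  have e3 : (α_ X Y T).inv ≫ (α_ X Y T).hom = 𝟙 _ := Iso.inv_hom_id _
  have h4 := D.classPullback_comp_linEquiv (α_ X Y T).hom.left (α_ X Y T).inv.left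
  rw [← Over.comp_left, e3, Over.id_left] at h4
  exact (D.classPullback_id_linEquiv.symm.trans h4).trans (h3.classPullback_zero _)

/-- **The cubical structure from the seesaw facts** (Görtz–Wedhorn II, Thm. 24.66, Lemma 24.72
⟹ Thm. 24.73 ⟹ Prop. 27.167). [cite: GortzWedhorn2023, Prop. 27.167, proof (pp. 877–878)] -/
theorem AbelianVariety.cubicalStructure_linEquiv_of_seesaw (A : AbelianVariety K)
    (hA : seesaw_isClosed_trivialLocus.{u}) (hB : seesaw_exists_linEquiv_classPullback.{u})
    (hC : theoremOfCube_isOpen_trivialLocus.{u}) : A.cubicalStructure_linEquiv :=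
  A.cubicalStructure_linEquiv_of_theoremOfCube (theoremOfCube_linEquiv_of_seesaw hA hB hC)

/-- **`[n]^*D ∼ n² D` for symmetric `D` from the seesaw facts** (Görtz–Wedhorn II, Thm. 24.66,
Lemma 24.72 ⟹ Thm. 24.73 ⟹ Prop. 27.167 ⟹ Prop. 27.184 (1), Rem. 27.185).
[cite: GortzWedhorn2023, Prop. 27.184 (1) (p. 886)] -/
theorem AbelianVariety.pullback_zsmul_id_linEquiv_of_seesaw (A : AbelianVariety K)
    (hA : seesaw_isClosed_trivialLocus.{u}) (hB : seesaw_exists_linEquiv_classPullback.{u})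
    (hC : theoremOfCube_isOpen_trivialLocus.{u}) : A.pullback_zsmul_id_linEquiv :=
  A.pullback_zsmul_id_linEquiv_of_theoremOfCube (theoremOfCube_linEquiv_of_seesaw hA hB hC)

/-- **The theorem of the cube from semicontinuity, seesaw and its local form** (Görtz–Wedhorn II,
Thm. 23.139 (2) + Lemma 24.65 ⟹ Thm. 24.66 (3); with Thm. 24.66 and Lemma 24.72 ⟹ Thm. 24.73):
`theoremOfCube_linEquiv_of_seesaw` with its first hypothesis discharged by
`seesaw_isClosed_trivialLocus_of_semicontinuity`.
[cite: GortzWedhorn2023, Thm. 24.73, proof (p. 550)] -/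
theorem theoremOfCube_linEquiv_of_semicontinuity (hA : semicontinuity_isClosed_sectionLocus.{u})
    (hB : seesaw_exists_linEquiv_classPullback.{u}) (hC : theoremOfCube_isOpen_trivialLocus.{u}) :
    theoremOfCube_linEquiv.{u} :=
  theoremOfCube_linEquiv_of_seesaw (seesaw_isClosed_trivialLocus_of_semicontinuity hA) hB hC

/-- The cubical structure of an abelian variety from semicontinuity, seesaw and the local form of
the theorem of the cube (Görtz–Wedhorn II, Thm. 23.139, Thm. 24.66, Lemma 24.72 ⟹ Thm. 24.73 ⟹
Prop. 27.167). [cite: GortzWedhorn2023, Prop. 27.167, proof (pp. 877–878)] -/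
theorem AbelianVariety.cubicalStructure_linEquiv_of_semicontinuity (A : AbelianVariety K)
    (hA : semicontinuity_isClosed_sectionLocus.{u}) (hB : seesaw_exists_linEquiv_classPullback.{u})
    (hC : theoremOfCube_isOpen_trivialLocus.{u}) : A.cubicalStructure_linEquiv :=
  A.cubicalStructure_linEquiv_of_theoremOfCube (theoremOfCube_linEquiv_of_semicontinuity hA hB hC)

/-- `[n]^*D ∼ n² D` for symmetric `D` from semicontinuity, seesaw and the local form of the
theorem of the cube (Görtz–Wedhorn II, Thm. 23.139, Thm. 24.66, Lemma 24.72 ⟹ Thm. 24.73 ⟹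
Prop. 27.167 ⟹ Prop. 27.184 (1), Rem. 27.185). [cite: GortzWedhorn2023, Prop. 27.184 (1) (p. 886)] -/
theorem AbelianVariety.pullback_zsmul_id_linEquiv_of_semicontinuity (A : AbelianVariety K)
    (hA : semicontinuity_isClosed_sectionLocus.{u}) (hB : seesaw_exists_linEquiv_classPullback.{u})
    (hC : theoremOfCube_isOpen_trivialLocus.{u}) : A.pullback_zsmul_id_linEquiv :=
  A.pullback_zsmul_id_linEquiv_of_theoremOfCube (theoremOfCube_linEquiv_of_semicontinuity hA hB hC)

/-! ### The theorem of the cube from the current leaves of the decomposition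

The reductions landed in this directory compose to a proof of `theoremOfCube_linEquiv` from three
named facts: the pseudo-coherence of the Čech complex of `𝒪(D)` over an affine of the base
(`cechComplex_pseudoCoherent_general`, `Motives/GrothendieckComplexSectionAlongCech`), Step (I) of
the proof of Görtz–Wedhorn II, Lemma 24.72 (`theoremOfCube_trivialAlong_thickeningPt`,
`Motives/TheoremOfCubeThickenings`) and the descent of the fibre condition along the stages of a
limit presentation of the base (`trivialLocus_descendsAlongStages`,
`Motives/TheoremOfCubeLimitProofs`). -/

section Leaves

/-- **Thm. 24.66 (3) (closedness of the trivial locus) from the pseudo-coherence of the Čech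
complex of `𝒪(D)`** (`cechComplex_pseudoCoherent_of_general`, `cechComplex_perfect_of_pseudoCoherent`,
`seesaw_isClosed_trivialLocus_of_perfect`).
[cite: GortzWedhorn2023, Thm. 24.66 (3), proof (pp. 545–546), via Thm. 23.133 / Cor. 23.135 (pp. 478–480)] -/
theorem seesaw_isClosed_trivialLocus_of_pseudoCoherent_general
    (h : cechComplex_pseudoCoherent_general.{u}) : seesaw_isClosed_trivialLocus.{u} :=
  seesaw_isClosed_trivialLocus_of_perfect
    (cechComplex_perfect_of_pseudoCoherent (cechComplex_pseudoCoherent_of_general h))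

/-- **Grauert's theorem in degree `0` for `𝒪(D)` on `X ×_K T → T` (`grothendieckComplex_sectionsOver`,
`Motives/SeesawGrauert`) from the pseudo-coherence of the Čech complex**
(`grothendieckComplex_sectionsOver_of_perfect` of `Motives/SeesawGrauertAffineCech`).
[cite: GortzWedhorn2023, Cor. 23.135, Cor. 23.137 (p. 480) and Thm. 23.140 (3) (p. 483)] -/
theorem grothendieckComplex_sectionsOver_of_pseudoCoherent_general
    (h : cechComplex_pseudoCoherent_general.{u}) : grothendieckComplex_sectionsOver.{u} :=
  grothendieckComplex_sectionsOver_of_perfect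
    (cechComplex_perfect_of_pseudoCoherent (cechComplex_pseudoCoherent_of_general h))

/-- **The semicontinuity fact `semicontinuity_isClosed_sectionLocus` (Görtz–Wedhorn II,
Thm. 23.139 (2) for `H⁰` of `𝒪(D_t)`) from the pseudo-coherence of the Čech complex** (through the
fibre clause of `grothendieckComplex_sectionsOver`, `Motives/SeesawGrauert`, and
`semicontinuity_isClosed_sectionLocus_of_sectionsFibre`, `Motives/SeesawSemicontinuityKernelRank`).
[cite: GortzWedhorn2023, Thm. 23.139 (2) (p. 482), proof via Cor. 23.135 and Prop. 23.117 (pp. 466–467, 480–482)] -/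
theorem semicontinuity_isClosed_sectionLocus_of_pseudoCoherent_general
    (h : cechComplex_pseudoCoherent_general.{u}) : semicontinuity_isClosed_sectionLocus.{u} :=
  semicontinuity_isClosed_sectionLocus_of_sectionsFibre
    (grothendieckComplex_sectionsFibre_of_sectionsOver
      (grothendieckComplex_sectionsOver_of_pseudoCoherent_general h))

/-- **The Seesaw Theorem `seesaw_exists_linEquiv_classPullback` (Görtz–Wedhorn II, Thm. 24.66) from
the pseudo-coherence of the Čech complex of `𝒪(D)`**
(`seesaw_exists_linEquiv_classPullback_of_grothendieckComplex_sectionsOver`, `Motives/SeesawGrauert`).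
[cite: GortzWedhorn2023, Thm. 24.66, proof (pp. 544–546), via Thm. 23.140 (3) (p. 483)] -/
theorem seesaw_exists_linEquiv_classPullback_of_pseudoCoherent_general
    (h : cechComplex_pseudoCoherent_general.{u}) : seesaw_exists_linEquiv_classPullback.{u} :=
  seesaw_exists_linEquiv_classPullback_of_grothendieckComplex_sectionsOver
    (grothendieckComplex_sectionsOver_of_pseudoCoherent_general h)

/-- **Görtz–Wedhorn II, Cor. 23.137 in degree `0` for `𝒪(D)` on `P ×_K T → T`
(`grothendieckComplex_sectionAlong`, `Motives/GrothendieckComplexSectionAlong`) from the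
pseudo-coherence of the Čech complex** (`grothendieckComplex_sectionAlong_of_cech` of
`Motives/GrothendieckComplexSectionAlongCech` with its second hypothesis discharged by
`cechComplex_h0_sectionAlong_holds` of `Motives/GrothendieckComplexSectionAlongCechProofs`).
[cite: GortzWedhorn2023, Cor. 23.137 with Thm. 23.133, proof, and Cor. 23.135 (pp. 478–480)] -/
theorem grothendieckComplex_sectionAlong_of_pseudoCoherent_general
    (h : cechComplex_pseudoCoherent_general.{u}) : grothendieckComplex_sectionAlong.{u} :=
  grothendieckComplex_sectionAlong_of_cech h cechComplex_h0_sectionAlong_holds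

/-- **The theorem on formal functions for `H⁰` of `𝒪(D)` (`formalFunctions_exists_isSectionOver_restrict`,
Görtz–Wedhorn II, Thm. 24.42 for `p = 0`) from the pseudo-coherence of the Čech complex**
(`formalFunctions_exists_isSectionOver_restrict_of_grothendieckComplex_sectionAlong`,
`Motives/TheoremOfCubeFormalLiftProofs`).
[cite: GortzWedhorn2023, Thm. 24.42 with (24.8.1) (p. 529), via Cor. 23.137 (p. 480)] -/
theorem formalFunctions_exists_isSectionOver_restrict_of_pseudoCoherent_general
    (h : cechComplex_pseudoCoherent_general.{u}) :
    formalFunctions_exists_isSectionOver_restrict.{u} :=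
  formalFunctions_exists_isSectionOver_restrict_of_grothendieckComplex_sectionAlong
    (grothendieckComplex_sectionAlong_of_pseudoCoherent_general h)

/-- **Step (II) of the proof of Görtz–Wedhorn II, Lemma 24.72
(`isTrivialOver_nhds_of_trivialAlong_thickeningPt`, `Motives/TheoremOfCubeThickenings`) from the
pseudo-coherence of the Čech complex alone**
(`isTrivialOver_nhds_of_trivialAlong_thickeningPt_of_grothendieckComplex_sectionAlong`,
`Motives/TheoremOfCubeFormalLiftProofs`). [cite: GortzWedhorn2023, Lemma 24.72, proof, Step (II) (p. 549)] -/
theorem isTrivialOver_nhds_of_trivialAlong_thickeningPt_of_pseudoCoherent_general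
    (h : cechComplex_pseudoCoherent_general.{u}) :
    isTrivialOver_nhds_of_trivialAlong_thickeningPt.{u} :=
  isTrivialOver_nhds_of_trivialAlong_thickeningPt_of_grothendieckComplex_sectionAlong
    (grothendieckComplex_sectionAlong_of_pseudoCoherent_general h)

/-- **The conclusion of Görtz–Wedhorn II, Lemma 24.72 for `𝒪(D)` on `(X × Y) × T → T` over a
general integral base (`theoremOfCube_isTrivialOver_nhds`, `Motives/TheoremOfCubeLocal`) from the
three leaves**: the pseudo-coherence of the Čech complex (for Step (II), through the theorem on
formal functions,
`theoremOfCube_isTrivialOver_nhds_locallyNoetherian_of_cube_stepI_of_formalFunctions`), Step (I)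
(`theoremOfCube_trivialAlong_thickeningPt`) and the descent of the fibre condition
(`trivialLocus_descendsAlongStages`, giving `theoremOfCube_noetherianDescent` by
`theoremOfCube_noetherianDescent_of_fibre` of `Motives/TheoremOfCubeLimitProofs`), assembled by
`theoremOfCube_isTrivialOver_nhds_of_locallyNoetherian_of_descent` of `Motives/TheoremOfCubeLimit`.
[cite: GortzWedhorn2023, Lemma 24.72, proof (pp. 548–549), with Thm. 23.133, Step (IV) (p. 479)] -/
theorem theoremOfCube_isTrivialOver_nhds_of_pseudoCoherent_of_stepI_of_fibre
    (h : cechComplex_pseudoCoherent_general.{u}) (hI : theoremOfCube_trivialAlong_thickeningPt.{u})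
    (hfib : trivialLocus_descendsAlongStages.{u}) : theoremOfCube_isTrivialOver_nhds.{u} :=
  theoremOfCube_isTrivialOver_nhds_of_locallyNoetherian_of_descent
    (theoremOfCube_isTrivialOver_nhds_locallyNoetherian_of_cube_stepI_of_formalFunctions hI
      (formalFunctions_exists_isSectionOver_restrict_of_pseudoCoherent_general h))
    (theoremOfCube_noetherianDescent_of_fibre hfib)

/-- **Openness of the trivial locus in the cube situation (`theoremOfCube_isOpen_trivialLocus`,
Görtz–Wedhorn II, Lemma 24.72 as used in the proof of Thm. 24.73) from the three leaves**
(`theoremOfCube_isOpen_trivialLocus_of_isTrivialOver_nhds`, `Motives/TheoremOfCubeLocal`).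
[cite: GortzWedhorn2023, Lemma 24.72 (p. 548) and proof of Thm. 24.73 (p. 550)] -/
theorem theoremOfCube_isOpen_trivialLocus_of_pseudoCoherent_of_stepI_of_fibre
    (h : cechComplex_pseudoCoherent_general.{u}) (hI : theoremOfCube_trivialAlong_thickeningPt.{u})
    (hfib : trivialLocus_descendsAlongStages.{u}) : theoremOfCube_isOpen_trivialLocus.{u} :=
  theoremOfCube_isOpen_trivialLocus_of_isTrivialOver_nhds
    (theoremOfCube_isTrivialOver_nhds_of_pseudoCoherent_of_stepI_of_fibre h hI hfib)

/-- **The Theorem of the Cube (`theoremOfCube_linEquiv`, Görtz–Wedhorn II, Thm. 24.73 over a field)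
from the three leaves of the decomposition of its printed proof in this directory**: the
pseudo-coherence of the Čech complex of `𝒪(D)` over an affine of the base
(`cechComplex_pseudoCoherent_general`: Thm. 23.133 / Cor. 23.135, finiteness of coherent
cohomology of proper morphisms), Step (I) of the proof of Lemma 24.72
(`theoremOfCube_trivialAlong_thickeningPt`: deformation theory and the Künneth formula) and the
descent of the fibre condition along a limit presentation of the base
(`trivialLocus_descendsAlongStages`). The first gives Thm. 24.66 (3) and Thm. 24.66
(`seesaw_isClosed_trivialLocus_of_pseudoCoherent_general`,
`seesaw_exists_linEquiv_classPullback_of_pseudoCoherent_general`), all three give the openness of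
the trivial locus (`theoremOfCube_isOpen_trivialLocus_of_pseudoCoherent_of_stepI_of_fibre`), and
`theoremOfCube_linEquiv_of_seesaw` assembles them. `theoremOfCube_linEquiv_holds` is this theorem
applied to the discharges of the three leaves.
[cite: GortzWedhorn2023, Thm. 24.73, proof (p. 550)] -/
theorem theoremOfCube_linEquiv_of_pseudoCoherent_of_stepI_of_fibre
    (h : cechComplex_pseudoCoherent_general.{u}) (hI : theoremOfCube_trivialAlong_thickeningPt.{u})
    (hfib : trivialLocus_descendsAlongStages.{u}) : theoremOfCube_linEquiv.{u} :=
  theoremOfCube_linEquiv_of_seesaw (seesaw_isClosed_trivialLocus_of_pseudoCoherent_general h)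
    (seesaw_exists_linEquiv_classPullback_of_pseudoCoherent_general h)
    (theoremOfCube_isOpen_trivialLocus_of_pseudoCoherent_of_stepI_of_fibre h hI hfib)

/-- **The cubical structure of an abelian variety from the three leaves** (Görtz–Wedhorn II,
Thm. 24.73 ⟹ Prop. 27.167). [cite: GortzWedhorn2023, Prop. 27.167, proof (pp. 877–878)] -/
theorem AbelianVariety.cubicalStructure_linEquiv_of_pseudoCoherent_of_stepI_of_fibre
    (A : AbelianVariety K) (h : cechComplex_pseudoCoherent_general.{u})
    (hI : theoremOfCube_trivialAlong_thickeningPt.{u}) (hfib : trivialLocus_descendsAlongStages.{u}) :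
    A.cubicalStructure_linEquiv :=
  A.cubicalStructure_linEquiv_of_theoremOfCube
    (theoremOfCube_linEquiv_of_pseudoCoherent_of_stepI_of_fibre h hI hfib)

/-- **`[n]^*D ∼ n² D` for symmetric `D` from the three leaves** (Görtz–Wedhorn II, Thm. 24.73 ⟹
Prop. 27.167 ⟹ Prop. 27.184 (1), Rem. 27.185). [cite: GortzWedhorn2023, Prop. 27.184 (1) (p. 886)] -/
theorem AbelianVariety.pullback_zsmul_id_linEquiv_of_pseudoCoherent_of_stepI_of_fibre
    (A : AbelianVariety K) (h : cechComplex_pseudoCoherent_general.{u})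
    (hI : theoremOfCube_trivialAlong_thickeningPt.{u}) (hfib : trivialLocus_descendsAlongStages.{u}) :
    A.pullback_zsmul_id_linEquiv :=
  A.pullback_zsmul_id_linEquiv_of_theoremOfCube
    (theoremOfCube_linEquiv_of_pseudoCoherent_of_stepI_of_fibre h hI hfib)

end Leaves

/-! ### The theorem of the cube from the pseudo-coherence of the Čech complex alone

With Step (I) of Lemma 24.72 (`theoremOfCube_trivialAlong_thickeningPt_holds`, `Motives/CubeStepI`)
and the descent of the fibre condition (`trivialLocus_descendsAlongStages_holds`,
`Motives/TheoremOfCubeLimitProofs`) proved, every statement of the section `Leaves` that took the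
three leaves now takes only `cechComplex_pseudoCoherent_general` (the one-leaf form of the
conclusion of Lemma 24.72 itself, `theoremOfCube_isTrivialOver_nhds_of_pseudoCoherent_general`,
lives in `Motives/TheoremOfCubeLocalProofs`, which is not imported here). -/

section OneLeaf

/-- **Openness of the trivial locus in the cube situation (`theoremOfCube_isOpen_trivialLocus`)
from the pseudo-coherence of the Čech complex alone.**
[cite: GortzWedhorn2023, Lemma 24.72 (p. 548) and proof of Thm. 24.73 (p. 550)] -/
theorem theoremOfCube_isOpen_trivialLocus_of_pseudoCoherent_general
    (h : cechComplex_pseudoCoherent_general.{u}) : theoremOfCube_isOpen_trivialLocus.{u} :=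
  theoremOfCube_isOpen_trivialLocus_of_pseudoCoherent_of_stepI_of_fibre h
    theoremOfCube_trivialAlong_thickeningPt_holds trivialLocus_descendsAlongStages_holds

/-- **The Theorem of the Cube (`theoremOfCube_linEquiv`, Görtz–Wedhorn II, Thm. 24.73 over a
field) from the single remaining named fact `cechComplex_pseudoCoherent_general`** (Thm. 23.133 /
Cor. 23.135: the Čech complex of `𝒪(D)` over an affine open of the base is pseudo-coherent —
finiteness of coherent cohomology of proper morphisms): Thm. 24.66 (1), (3) and Thm. 24.66 from
the pseudo-coherence (`seesaw_isClosed_trivialLocus_of_pseudoCoherent_general`,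
`seesaw_exists_linEquiv_classPullback_of_pseudoCoherent_general`), the openness of the trivial
locus from the pseudo-coherence with the proved Step (I) and fibre descent
(`theoremOfCube_isOpen_trivialLocus_of_pseudoCoherent_general`), assembled by
`theoremOfCube_linEquiv_of_seesaw`. `theoremOfCube_linEquiv_holds` is this theorem applied to
`cechComplex_pseudoCoherent_general_holds`. [cite: GortzWedhorn2023, Thm. 24.73, proof (p. 550)] -/
theorem theoremOfCube_linEquiv_of_pseudoCoherent_general
    (h : cechComplex_pseudoCoherent_general.{u}) : theoremOfCube_linEquiv.{u} :=
  theoremOfCube_linEquiv_of_pseudoCoherent_of_stepI_of_fibre h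
    theoremOfCube_trivialAlong_thickeningPt_holds trivialLocus_descendsAlongStages_holds

/-- **The cubical structure of an abelian variety from the pseudo-coherence of the Čech complex
alone** (Görtz–Wedhorn II, Thm. 24.73 ⟹ Prop. 27.167).
[cite: GortzWedhorn2023, Prop. 27.167, proof (pp. 877–878)] -/
theorem AbelianVariety.cubicalStructure_linEquiv_of_pseudoCoherent_general (A : AbelianVariety K)
    (h : cechComplex_pseudoCoherent_general.{u}) : A.cubicalStructure_linEquiv :=
  A.cubicalStructure_linEquiv_of_theoremOfCube (theoremOfCube_linEquiv_of_pseudoCoherent_general h)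

/-- **`[n]^*D ∼ n² D` for symmetric `D` from the pseudo-coherence of the Čech complex alone**
(Görtz–Wedhorn II, Thm. 24.73 ⟹ Prop. 27.167 ⟹ Prop. 27.184 (1), Rem. 27.185).
[cite: GortzWedhorn2023, Prop. 27.184 (1) (p. 886)] -/
theorem AbelianVariety.pullback_zsmul_id_linEquiv_of_pseudoCoherent_general (A : AbelianVariety K)
    (h : cechComplex_pseudoCoherent_general.{u}) : A.pullback_zsmul_id_linEquiv :=
  A.pullback_zsmul_id_linEquiv_of_theoremOfCube (theoremOfCube_linEquiv_of_pseudoCoherent_general h)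

end OneLeaf

/-! ### The theorem of the cube from the finiteness of Čech cohomology over a noetherian base -/

section NoetherianFiniteness

/-- **The Theorem of the Cube (`theoremOfCube_linEquiv`, Görtz–Wedhorn II, Thm. 24.73 over a
field) from the finiteness theorem for the coherent cohomology of proper morphisms over a
noetherian base, in Čech form for the sheaves `𝒪(D)`**: if for every field `K`, every proper
`X → Spec K`, every affine integral `K`-scheme `T` of finite type (`Γ(T, 𝒪)` noetherian) with
`X ×_K T` integral, every Cartier divisor `D` on `X ×_K T` and every Čech cover `𝔚` of `X ×_K T`
over `T` adapted to `D`, the cohomology modules of the ordered Čech complex `Č•(𝔚, 𝒪(D))` are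
finitely generated `Γ(T, 𝒪)`-modules (Görtz–Wedhorn II, Thm. 23.17 / Prop. 23.23 with Thm. 22.9;
EGA III 3.2.1; Stacks 02O5), then the Theorem of the Cube holds — by
`cechComplex_pseudoCoherent_general_of_finite_cohomology` (`Motives/CechComplexPseudoCoherentDescent`:
Step (IV) of the proof of Thm. 23.133, proved) and `theoremOfCube_linEquiv_of_pseudoCoherent_general`.
This hypothesis is all that separates `theoremOfCube_linEquiv` from a theorem of this tree.
[cite: GortzWedhorn2023, Thm. 24.73, proof (p. 550), with Thm. 23.133, proof (pp. 478–479) and Thm. 23.17 (p. 444)] -/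
theorem theoremOfCube_linEquiv_of_finite_cohomology
    (h : ∀ (K : Type u) [Field K] (X T : SchemeOver K) [IsProper X.hom] [IsAffine T.left]
      [IsIntegral T.left] [LocallyOfFiniteType T.hom] [IsNoetherianRing Γ(T.left, ⊤)]
      [IsIntegral (X ⊗ T).left] (D : CartierDivisor (X ⊗ T).left)
      (𝔚 : CartierDivisor.CechCover (snd X T).left ⊤ D) (n : ℤ),
      Module.Finite Γ(T.left, ⊤) (𝔚.complex.homology n)) :
    theoremOfCube_linEquiv.{u} :=
  theoremOfCube_linEquiv_of_pseudoCoherent_general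
    (cechComplex_pseudoCoherent_general_of_finite_cohomology h)

/-- **The cubical structure of an abelian variety from the finiteness of Čech cohomology over a
noetherian base** (Görtz–Wedhorn II, Thm. 24.73 ⟹ Prop. 27.167).
[cite: GortzWedhorn2023, Prop. 27.167, proof (pp. 877–878)] -/
theorem AbelianVariety.cubicalStructure_linEquiv_of_finite_cohomology (A : AbelianVariety K)
    (h : ∀ (K : Type u) [Field K] (X T : SchemeOver K) [IsProper X.hom] [IsAffine T.left]
      [IsIntegral T.left] [LocallyOfFiniteType T.hom] [IsNoetherianRing Γ(T.left, ⊤)]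
      [IsIntegral (X ⊗ T).left] (D : CartierDivisor (X ⊗ T).left)
      (𝔚 : CartierDivisor.CechCover (CartesianMonoidalCategory.snd X T).left ⊤ D) (n : ℤ),
      Module.Finite Γ(T.left, ⊤) (𝔚.complex.homology n)) :
    A.cubicalStructure_linEquiv :=
  A.cubicalStructure_linEquiv_of_theoremOfCube (theoremOfCube_linEquiv_of_finite_cohomology h)

/-- **`[n]^*D ∼ n² D` for symmetric `D` from the finiteness of Čech cohomology over a noetherian
base** (Görtz–Wedhorn II, Thm. 24.73 ⟹ Prop. 27.167 ⟹ Prop. 27.184 (1), Rem. 27.185).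
[cite: GortzWedhorn2023, Prop. 27.184 (1) (p. 886)] -/
theorem AbelianVariety.pullback_zsmul_id_linEquiv_of_finite_cohomology (A : AbelianVariety K)
    (h : ∀ (K : Type u) [Field K] (X T : SchemeOver K) [IsProper X.hom] [IsAffine T.left]
      [IsIntegral T.left] [LocallyOfFiniteType T.hom] [IsNoetherianRing Γ(T.left, ⊤)]
      [IsIntegral (X ⊗ T).left] (D : CartierDivisor (X ⊗ T).left)
      (𝔚 : CartierDivisor.CechCover (CartesianMonoidalCategory.snd X T).left ⊤ D) (n : ℤ),
      Module.Finite Γ(T.left, ⊤) (𝔚.complex.homology n)) :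
    A.pullback_zsmul_id_linEquiv :=
  A.pullback_zsmul_id_linEquiv_of_theoremOfCube (theoremOfCube_linEquiv_of_finite_cohomology h)

end NoetherianFiniteness

/-! ### The discharge: the Theorem of the Cube holds -/

section Discharge

/-- **The Theorem of the Cube holds** (Görtz–Wedhorn II, Thm. 24.73 over a field `K`, divisor form:
for `X`, `Y` proper geometrically integral `K`-schemes with rational points `x`, `y`, `T` an integral
`K`-scheme with a rational point `t₀` and a Cartier divisor `D` on `X × Y × T` whose class restricts
trivially to `{x} × Y × T`, `X × {y} × T` and `X × Y × {t₀}`, `D ∼ 0`) — the named fact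
`theoremOfCube_linEquiv` of `Motives/AbelianVarietyTheoremOfCube` is a theorem of this tree:
`theoremOfCube_linEquiv_of_pseudoCoherent_general` (the printed proof: Thm. 24.66 and Lemma 24.72
with the Künneth formula, reduced in this directory to the pseudo-coherence of the Čech complex of
`𝒪(D)`, Thm. 23.133 / Cor. 23.135) applied to `cechComplex_pseudoCoherent_general_holds`
(`Motives/CechComplexPseudoCoherentGeneralProofs`: the finiteness theorem for proper morphisms,
Thm. 23.17, by Chow's lemma, Serre's theorems and dévissage).
[cite: GortzWedhorn2023, Thm. 24.73 with proof (p. 550)] -/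
theorem theoremOfCube_linEquiv_holds : theoremOfCube_linEquiv.{u} :=
  theoremOfCube_linEquiv_of_pseudoCoherent_general cechComplex_pseudoCoherent_general_holds

end Discharge

end Literature.AlgebraicGeometry.Motives

end
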